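import Summits.QuantumFields.BalabanUV.T4Continuum.Support.VariationalTaxiScalarPair
import Summits.QuantumFields.BalabanUV.T4Continuum.Support.VariationalCovariantTower

/-!
# T⁴ programme, spine node NE2 (U1a), lane P2 — SUPPORT: THE COHERENT TAXI TOWER (U(1)), PART 1 — the nested taxi transports and the
# binders of the road owner's repaired END `VariationalCovariantEndRel.towerLimitRate_scalarTower_closed_rel` AT TAXI DATA, every level

NE2 formalisation swarm `b2b-balaban-t4-ne2-formalise-*`, leaf 04 GEN 3 (`prover-b2b-balaban-t4-ne2-formalise-leaf-04-g3-0`); register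
P2-sup item (O7) «TAXI TOWER END» (road owner `t4-ne2-p2` gen 11, journal CLAIMS.log l.10301 ∕ l.11012; this unit's INTENT l.11043).

THE DATA.  A COHERENT TOWER OF UNIT LATTICE PHASES: for every level `k` the one-step data `R′ k : Tor (fine L (fine (L^k) M)) → Fin d → ℂ`
(the level-`k+1` bond phases presented over the level-`k` torus), `|R′ k| = 1`, plaquette defect `‖plaq (R′ k) − 1‖ ≤ a′_k`, and the
COHERENCE `coarseT L (fine (L^(k+1)) M) (R′ (k+1)) = Rtr (L^k) L M (R′ k)` — each level's straight `L`-bond coarsening IS the previous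
level's phases (the lattice samples of one continuum connection; `VariationalTaxiCoarse.coarseT`, [Balaban1985BackgroundPropagators] (3.19)
p.393 «Ū» SHAPE only, abelian).  The level-`k` phases are `Rc k := coarseT L (fine (L^k) M) (R′ k)`.

THE OBJECTS ([folklore], OURS).
 * `nestT L M R′ : (k : ℕ) → Tor (fine (L^k) M) → ℂ` — THE NESTED TAXI TOWER: at level `0` the straight taxi of `Rc 0` (trivial blocks), and
   `nestT (k+1) = compT (L^k) L M (nestT k) (taxiT L (fine (L^k) M) (R′ k))` (the road's COMP⁺ `VariationalCovariantTower.compT` composed with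
   the one-step taxi contours `VariationalTaxiTransport.taxiT` of leaf-04 gen 2) — COMP⁺ holds BY `rfl`, `|nestT| = 1`;
 * the REFERENCE transports of the repaired END are the STRAIGHT taxis `taxiT (L^k) M (Rc k)`.
THE THEOREMS — the END's binders at taxi data, ∀ k, as functions of the plaquette defects `a′_k` alone (leaf-04 gen 2's dictionary
`inBlock_defect_taxiT_le` ∕ `inBlock_defect_taxiT_le'` ∕ `cross_defect_taxiT_le` ∕ `norm_mis_taxiT_le` ∕ `coarse_comm_le` ∕ `taxi_class_bounds`
BY NAME, re-indexed along the tower): `plaq_coarseT_sub_one_le` (the straight coarse phases have plaquette defect `L²a′`), `hwin_taxiTower`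
(reference in-block defect `w_k = (d−1)(L^k−1)·L²a′_k`), `hP_taxiTower` (`a_k = L²a′_k`), `hin_taxiTower` ∕ `hcross_taxiTower`
(`m₁,k = (d−1)(L−1)(L+1)a′_k`), `hmis_taxiTower` (`m_k = (d−1)L(L−1)a′_k`), and §3 the CLASS: under ONE scale-invariant hypothesis
`(L^k·L)²·a′_k ≤ c` the END's class constants are `c_a = c`, `c_m = c₁ = (d−1)c`, the reference `n·w_k ≤ (d−1)c`, the fictitious UB⁺-rel
defect `w′_k := c_w′∕L^k`, `c_w′ = (4 + (d−1)c)∕(1−γ)` (`hw'_taxiTower`), and the FED⁺ absorption follows from `512d²((d−1)c)² ≤ ½`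
(`habsorb_taxiTower`).  PART 2 (`VariationalTaxiTowerEnd`) feeds these to the END; the one binder NOT here is the nested-vs-straight
relative phase `‖nestT k x·conj (taxiT (Rc k) x) − 1‖ ≤ γ` (register item (O10), leaf-01 gen 4) — at level 0 it is `0` (`nestT_zero_rel`).

HONEST FRAMING (T4-DAG p. 1).  Bookkeeping at MODEL level (U(1) phases as DATA, abelian taxi ∕ straight contours, OUR typed objects);
[folklore]; nothing printed is a hypothesis; two data `def`s (`nestT` and nothing else is new), no `def … : Prop`; no `sorry`; axioms standard.
NOT the non-abelian ordered products, NOT tier B, NOT NE2⁺ as printed; NE2 NOT proved; spine 0/9; rung (B)+1 finite T⁴ — NOT infinite volume,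
NOT mass gap, NOT Clay.  HONEST DEPENDENCY (cell, verbatim): continuum YM on T⁴ ⇐ BetaPertH ∧ nine spine estimates (0/9 proved);
BetaPertH ⇐ (D1) ∧ (D4) ∧ CAP+tail; G-an2-4 gates asym, D1 and NE2/3/4.
-/

noncomputable section

open scoped BigOperators ComplexConjugate
open Finset

namespace Summit.QuantumFields.BalabanUV.T4Continuum.VariationalTaxiTower

open Literature.MathematicalPhysics.QuantumFieldTheory.Balaban1983to89.B5Prop11Plancherel (Tor fine unitVec)
open Literature.MathematicalPhysics.QuantumFieldTheory.Balaban1983to89.B5Block118 (bpt)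
open Summit.QuantumFields.BalabanUV.T4Continuum.VariationalCovariantFederbush (piT mis)
open Summit.QuantumFields.BalabanUV.T4Continuum.VariationalCovariantUpperBound (mul_conj_of_norm_one)
open Summit.QuantumFields.BalabanUV.T4Continuum.VariationalCovariantTower (compT Rtr norm_compT)
open Summit.QuantumFields.BalabanUV.T4Continuum.VariationalTaxiTransport
open Summit.QuantumFields.BalabanUV.T4Continuum.VariationalTaxiCoarse
open Summit.QuantumFields.BalabanUV.T4Continuum.VariationalTaxiCoarseBinders
open Summit.QuantumFields.BalabanUV.T4Continuum.VariationalTaxiScalarPair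

variable {d : ℕ} (L : ℕ) [NeZero L] (M : Fin d → ℕ) [hM : ∀ μ, NeZero (M μ)]

/-! ## §1 The nested taxi tower -/

section Nest

/-- **THE NESTED TAXI TOWER** over a tower of one-step phases `R′ k`: level `0` = the straight taxi of the level-`0` phases
`coarseT L (fine 1 M) (R′ 0)` (blocks of side `1`), level `k+1` = `compT (nestT k) (taxiT (R′ k))` — Bałaban's nested contours Γ^{(j)}
([Balaban1985BackgroundPropagators] (3.15) p.393 SHAPE only; abelian; phases as data). [folklore] -/
def nestT (R' : (k : ℕ) → Tor (fine L (fine (L ^ k) M)) → Fin d → ℂ) : (k : ℕ) → Tor (fine (L ^ k) M) → ℂ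
  | 0 => taxiT (L ^ 0) M (coarseT L (fine (L ^ 0) M) (R' 0))
  | k + 1 => compT (L ^ k) L M (nestT R' k) (taxiT L (fine (L ^ k) M) (R' k))

variable (R' : (k : ℕ) → Tor (fine L (fine (L ^ k) M)) → Fin d → ℂ)

/-- level `0` of the nested tower is the straight taxi. [folklore] -/
theorem nestT_zero : nestT L M R' 0 = taxiT (L ^ 0) M (coarseT L (fine (L ^ 0) M) (R' 0)) := rfl

/-- **COMP⁺ BY `rfl`**: `nestT (k+1) = compT (L^k) L M (nestT k) (taxiT L _ (R′ k))` — literally the END's binder `hTcomp`. [folklore] -/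
theorem nestT_succ (k : ℕ) : nestT L M R' (k + 1) = compT (L ^ k) L M (nestT L M R' k) (taxiT L (fine (L ^ k) M) (R' k)) := rfl

variable {R'} (hR1 : ∀ k x μ, ‖R' k x μ‖ = 1)
include hR1

omit hM in
/-- the straight coarse phases are unit: the END's binder `hRc1`. [folklore] -/
theorem norm_coarseT_tower (k : ℕ) (y : Tor (fine (L ^ k) M)) (μ : Fin d) : ‖coarseT L (fine (L ^ k) M) (R' k) y μ‖ = 1 :=
  norm_coarseT L (fine (L ^ k) M) (hR1 k) y μ

omit [NeZero L] hM in
/-- the one-step phases are contractive: the END's binder `hR'`. [folklore] -/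
theorem norm_R'_le (k : ℕ) (x : Tor (fine L (fine (L ^ k) M))) (μ : Fin d) : ‖R' k x μ‖ ≤ 1 := (hR1 k x μ).le

/-- the one-step taxis are unit: the END's binder `hT'1`. [folklore] -/
theorem norm_taxiT_step (k : ℕ) (x : Tor (fine L (fine (L ^ k) M))) : ‖taxiT L (fine (L ^ k) M) (R' k) x‖ = 1 :=
  norm_taxiT L (fine (L ^ k) M) (hR1 k) x

/-- the straight reference taxis are unit: the END's binder `hT₀`. [folklore] -/
theorem norm_taxiT_ref (k : ℕ) (x : Tor (fine (L ^ k) M)) : ‖taxiT (L ^ k) M (coarseT L (fine (L ^ k) M) (R' k)) x‖ = 1 :=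
  norm_taxiT (L ^ k) M (norm_coarseT_tower L M hR1 k) x

/-- `|nestT| = 1`: the END's binder `hT`. [folklore] -/
theorem norm_nestT : ∀ (k : ℕ) (x : Tor (fine (L ^ k) M)), ‖nestT L M R' k x‖ = 1
  | 0, x => norm_taxiT_ref L M hR1 0 x
  | k + 1, x => norm_compT (L ^ k) L M (norm_nestT k) (norm_taxiT_step L M hR1 k) x

/-- at level `0` the nested and the straight taxi coincide, so the relative phase vanishes. [folklore] -/
theorem nestT_zero_rel (x : Tor (fine (L ^ 0) M)) :
    ‖nestT L M R' 0 x * conj (taxiT (L ^ 0) M (coarseT L (fine (L ^ 0) M) (R' 0)) x) - 1‖ = 0 := by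
  rw [nestT_zero, (mul_conj_of_norm_one (norm_taxiT_ref L M hR1 0 x)).1, sub_self, norm_zero]

end Nest

/-! ## §2 The END's transport defects at taxi data, every level -/

section Defects

omit hM in
/-- the straight coarse phases have plaquette defect `L²·a′` in `plaq` form (`coarse_comm_le` + `norm_plaq_sub_one_eq`). [folklore] -/
theorem plaq_coarseT_sub_one_le {n : ℕ} [NeZero n] {R : Tor (fine L (fine n M)) → Fin d → ℂ} (hR : ∀ x μ, ‖R x μ‖ = 1)
    {a' : ℝ} (ha' : ∀ x κ ι, ‖plaq L (fine n M) R x κ ι - 1‖ ≤ a') (x : Tor (fine n M)) (κ ν : Fin d) :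
    ‖plaq n M (coarseT L (fine n M) R) x κ ν - 1‖ ≤ (L : ℝ) * L * a' := by
  rw [norm_plaq_sub_one_eq n M (norm_coarseT L (fine n M) hR)]
  exact coarse_comm_le L (fine n M) hR ha' x κ ν

variable {R' : (k : ℕ) → Tor (fine L (fine (L ^ k) M)) → Fin d → ℂ} (hR1 : ∀ k x μ, ‖R' k x μ‖ = 1)
variable {a' : ℕ → ℝ} (ha' : ∀ k x κ ι, ‖plaq L (fine (L ^ k) M) (R' k) x κ ι - 1‖ ≤ a' k)
include hR1 ha'

omit hM in
/-- REG⁺ binder `hP` at taxi data: the level-`k` phases commute up to `a_k := L·L·a′_k`. [folklore] -/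
theorem hP_taxiTower (k : ℕ) (x : Tor (fine (L ^ k) M)) (μ ν : Fin d) :
    ‖coarseT L (fine (L ^ k) M) (R' k) x μ * coarseT L (fine (L ^ k) M) (R' k) (x + unitVec (fine (L ^ k) M) μ) ν
        - coarseT L (fine (L ^ k) M) (R' k) x ν * coarseT L (fine (L ^ k) M) (R' k) (x + unitVec (fine (L ^ k) M) ν) μ‖
      ≤ (L : ℝ) * L * a' k :=
  coarse_comm_le L (fine (L ^ k) M) (hR1 k) (ha' k) x μ ν

/-- UB⁺-rel binder `hwin` at taxi data: the STRAIGHT reference taxi of the level-`k` phases has in-block defect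
`w_k := (d−1)(L^k−1)·(L·L·a′_k)`. [folklore] -/
theorem hwin_taxiTower (k : ℕ) (y : Tor M) (j : Fin d → Fin (L ^ k)) (μ : Fin d) (h : (j μ : ℕ) + 1 < L ^ k) :
    ‖coarseT L (fine (L ^ k) M) (R' k) (bpt (L ^ k) M y j) μ
          * conj (taxiT (L ^ k) M (coarseT L (fine (L ^ k) M) (R' k)) (bpt (L ^ k) M y j + unitVec (fine (L ^ k) M) μ))
          * taxiT (L ^ k) M (coarseT L (fine (L ^ k) M) (R' k)) (bpt (L ^ k) M y j) - 1‖
      ≤ ((d - 1 : ℕ) : ℝ) * ((L ^ k - 1 : ℕ) : ℝ) * ((L : ℝ) * L * a' k) :=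
  inBlock_defect_taxiT_le (L ^ k) M (norm_coarseT_tower L M hR1 k) (plaq_coarseT_sub_one_le L M (hR1 k) (ha' k)) y j μ h

/-- ONE⁺ binder `hin` at taxi data: `m₁,k := (d−1)(L−1)(L+1)·a′_k`. [folklore] -/
theorem hin_taxiTower (k : ℕ) (y : Tor (fine (L ^ k) M)) (j : Fin d → Fin L) (μ : Fin d) (h : (j μ : ℕ) + 1 < L) :
    ‖R' k (bpt L (fine (L ^ k) M) y j) μ
          * conj (taxiT L (fine (L ^ k) M) (R' k) (bpt L (fine (L ^ k) M) y j + unitVec (fine L (fine (L ^ k) M)) μ))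
          * taxiT L (fine (L ^ k) M) (R' k) (bpt L (fine (L ^ k) M) y j) - 1‖
      ≤ ((d - 1 : ℕ) : ℝ) * ((L - 1 : ℕ) : ℝ) * ((L : ℝ) + 1) * a' k :=
  inBlock_defect_taxiT_le' L (fine (L ^ k) M) (hR1 k) (ha' k) y j μ h

/-- ONE⁺ binder `hcross` at taxi data, same `m₁,k`. [folklore] -/
theorem hcross_taxiTower (k : ℕ) (y : Tor (fine (L ^ k) M)) (j : Fin d → Fin L) (μ : Fin d) (h : (j μ : ℕ) + 1 = L) :
    ‖R' k (bpt L (fine (L ^ k) M) y j) μ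
          * conj (taxiT L (fine (L ^ k) M) (R' k) (bpt L (fine (L ^ k) M) y j + unitVec (fine L (fine (L ^ k) M)) μ))
          * taxiT L (fine (L ^ k) M) (R' k) (bpt L (fine (L ^ k) M) y j) - coarseT L (fine (L ^ k) M) (R' k) y μ‖
      ≤ ((d - 1 : ℕ) : ℝ) * ((L - 1 : ℕ) : ℝ) * ((L : ℝ) + 1) * a' k :=
  cross_defect_taxiT_le L (fine (L ^ k) M) (hR1 k) (ha' k) y j μ h

/-- FED⁺ binder `hmis` at taxi data: `m_k := (d−1)·L(L−1)·a′_k`. [folklore] -/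
theorem hmis_taxiTower (k : ℕ) (y : Tor (fine (L ^ k) M)) (μ : Fin d) (j : Fin d → Fin L) :
    ‖mis L (fine (L ^ k) M) (coarseT L (fine (L ^ k) M) (R' k)) (R' k) (taxiT L (fine (L ^ k) M) (R' k)) y μ j‖
      ≤ ((d - 1 : ℕ) : ℝ) * ((L : ℝ) * ((L - 1 : ℕ) : ℝ) * a' k) :=
  norm_mis_taxiT_le L (fine (L ^ k) M) (hR1 k) (ha' k) y μ j

end Defects

/-! ## §3 The CLASS at taxi data along the tower: one scale-invariant hypothesis `(L^k·L)²·a′_k ≤ c` -/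

section Class

variable {a' : ℕ → ℝ} (ha0 : ∀ k, 0 ≤ a' k) {c : ℝ} (hclass : ∀ k, ((((L ^ k : ℕ)) : ℝ) * L) ^ 2 * a' k ≤ c)
include ha0 hclass

/-- the four CLASS lines of the END at taxi data, level `k` (`taxi_class_bounds` at `n = L^k`): reference `n·w_k ≤ (d−1)c`, `a_k·n² ≤ c`,
`n²·m_k ≤ (d−1)c`, `n²·m₁,k ≤ (d−1)c`. [folklore] -/
theorem class_taxiTower (k : ℕ) :
    (((L ^ k : ℕ)) : ℝ) * (((d - 1 : ℕ) : ℝ) * ((L ^ k - 1 : ℕ) : ℝ) * ((L : ℝ) * L * a' k)) ≤ ((d - 1 : ℕ) : ℝ) * c ∧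
      (L : ℝ) * L * a' k * (((L ^ k : ℕ)) : ℝ) ^ 2 ≤ c ∧
      (((L ^ k : ℕ)) : ℝ) ^ 2 * (((d - 1 : ℕ) : ℝ) * ((L : ℝ) * ((L - 1 : ℕ) : ℝ) * a' k)) ≤ ((d - 1 : ℕ) : ℝ) * c ∧
      (((L ^ k : ℕ)) : ℝ) ^ 2 * (((d - 1 : ℕ) : ℝ) * ((L - 1 : ℕ) : ℝ) * ((L : ℝ) + 1) * a' k) ≤ ((d - 1 : ℕ) : ℝ) * c :=
  taxi_class_bounds (n := L ^ k) (Nat.one_le_iff_ne_zero.mpr (NeZero.ne L)) (ha0 k) (hclass k)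

/-- the FED⁺ ABSORPTION of the END at taxi data from ONE smallness of the class constant: `512d²((d−1)c)² ≤ ½ ⇒ 512d²(n·m_k)² ≤ ½`
(`n·m_k ≤ n²·m_k ≤ (d−1)c`). [folklore] -/
theorem habsorb_taxiTower (hcabs : 512 * (d : ℝ) ^ 2 * (((d - 1 : ℕ) : ℝ) * c) ^ 2 ≤ 1 / 2) (k : ℕ) :
    512 * (d : ℝ) ^ 2 * ((((L ^ k : ℕ)) : ℝ) * (((d - 1 : ℕ) : ℝ) * ((L : ℝ) * ((L - 1 : ℕ) : ℝ) * a' k))) ^ 2 ≤ 1 / 2 := by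
  have hn1 : (1 : ℝ) ≤ (((L ^ k : ℕ)) : ℝ) := by exact_mod_cast Nat.one_le_iff_ne_zero.mpr (NeZero.ne (L ^ k))
  have hm0 : 0 ≤ ((d - 1 : ℕ) : ℝ) * ((L : ℝ) * ((L - 1 : ℕ) : ℝ) * a' k) := by have := ha0 k; positivity
  have h2 := (class_taxiTower (d := d) L ha0 hclass k).2.2.1
  have hnm : (((L ^ k : ℕ)) : ℝ) * (((d - 1 : ℕ) : ℝ) * ((L : ℝ) * ((L - 1 : ℕ) : ℝ) * a' k)) ≤ ((d - 1 : ℕ) : ℝ) * c := by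
    refine le_trans ?_ h2
    have : (((L ^ k : ℕ)) : ℝ) ≤ (((L ^ k : ℕ)) : ℝ) ^ 2 := by nlinarith
    exact mul_le_mul_of_nonneg_right this hm0
  have hnm0 : 0 ≤ (((L ^ k : ℕ)) : ℝ) * (((d - 1 : ℕ) : ℝ) * ((L : ℝ) * ((L - 1 : ℕ) : ℝ) * a' k)) := by positivity
  have hsq : ((((L ^ k : ℕ)) : ℝ) * (((d - 1 : ℕ) : ℝ) * ((L : ℝ) * ((L - 1 : ℕ) : ℝ) * a' k))) ^ 2 ≤ (((d - 1 : ℕ) : ℝ) * c) ^ 2 :=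
    pow_le_pow_left₀ hnm0 hnm 2
  nlinarith [sq_nonneg (d : ℝ)]

/-- the fictitious UB⁺-rel defect line of the END at taxi data: with `c_w′ := (4 + (d−1)c)∕(1−γ)` and `w′_k := c_w′∕L^k`,
`(4 + n·w_k)∕(1−γ) − 1 ≤ n·w′_k`, `n·w′_k ≤ c_w′`, `0 ≤ w′_k`. [folklore] -/
theorem hw'_taxiTower {γ : ℝ} (hγ : γ < 1) (k : ℕ) :
    (4 + (((L ^ k : ℕ)) : ℝ) * (((d - 1 : ℕ) : ℝ) * ((L ^ k - 1 : ℕ) : ℝ) * ((L : ℝ) * L * a' k))) / (1 - γ) - 1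
        ≤ (((L ^ k : ℕ)) : ℝ) * ((4 + ((d - 1 : ℕ) : ℝ) * c) / (1 - γ) / (((L ^ k : ℕ)) : ℝ)) ∧
      (((L ^ k : ℕ)) : ℝ) * ((4 + ((d - 1 : ℕ) : ℝ) * c) / (1 - γ) / (((L ^ k : ℕ)) : ℝ)) ≤ (4 + ((d - 1 : ℕ) : ℝ) * c) / (1 - γ) ∧
      0 ≤ (4 + ((d - 1 : ℕ) : ℝ) * c) / (1 - γ) / (((L ^ k : ℕ)) : ℝ) := by
  have hn : (0 : ℝ) < (((L ^ k : ℕ)) : ℝ) := by exact_mod_cast Nat.pos_of_ne_zero (NeZero.ne (L ^ k))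
  have hγ' : 0 < 1 - γ := by linarith
  have hc0 : 0 ≤ c := le_trans (by have := ha0 0; positivity) (hclass 0)
  have h1 := (class_taxiTower (d := d) L ha0 hclass k).1
  have hcw0 : 0 ≤ (4 + ((d - 1 : ℕ) : ℝ) * c) / (1 - γ) := by positivity
  have hcancel : (((L ^ k : ℕ)) : ℝ) * ((4 + ((d - 1 : ℕ) : ℝ) * c) / (1 - γ) / (((L ^ k : ℕ)) : ℝ))
      = (4 + ((d - 1 : ℕ) : ℝ) * c) / (1 - γ) := mul_div_cancel₀ _ hn.ne'
  refine ⟨?_, hcancel.le, by positivity⟩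
  rw [hcancel]
  have hmono : (4 + (((L ^ k : ℕ)) : ℝ) * (((d - 1 : ℕ) : ℝ) * ((L ^ k - 1 : ℕ) : ℝ) * ((L : ℝ) * L * a' k))) / (1 - γ)
      ≤ (4 + ((d - 1 : ℕ) : ℝ) * c) / (1 - γ) := div_le_div_of_nonneg_right (by linarith) hγ'.le
  linarith

end Class

end Summit.QuantumFields.BalabanUV.T4Continuum.VariationalTaxiTower

end
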